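import Summits.HubbardSuperconductivity.HubbardSuperconductivity.Theorems.NodalWardXYPerturbedXYOrderReduction

/-!
# `PerturbedXYOrder` (stmt-HubbardSuperconductivity-10739) — line `schwarz-inheritance`, stub `stub_e3Laplace`

**Energy–entropy on the cube** (generic measure theory on `[0, 2π]^Λ`, `Λ = (ℤ/Lℤ)³`; one piece of the
exponent-`3` tightness chain).  For a continuous `F` and `a ≥ 0`: if `F ≤ R_A` wherever
`C(θ) := Σ_{x,y} cos(θ_x − θ_y) ≥ (a/2) L⁶` on the cube, and `F ≥ R_N` on a box `Π_x [c₀ x − δ, c₀ x + δ] ⊆ cube`,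
then the `e^F`-weighted cube average of `C` is at most `(a/2) L⁶ + L⁶ (2π)^|Λ| e^{R_A} / ((2δ)^|Λ| e^{R_N})`.

Proof.  Split the cube at the level set `A = {a/2 · L⁶ ≤ C}`: off `A`, `C e^F ≤ (a/2) L⁶ e^F`; on `A`,
`C ≤ L⁶` and `e^F ≤ e^{R_A}`, so `∫_{cube ∩ A} C e^F ≤ L⁶ e^{R_A} vol(cube) = L⁶ (2π)^|Λ| e^{R_A}`
(`lap_integral_mul_exp_le`).  The partition function is at least its box part,
`∫_cube e^F ≥ e^{R_N} vol(box) = (2δ)^|Λ| e^{R_N}` (`lap_box_le_integral`).  Divide.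
-/

noncomputable section

namespace Summit.HubbardSuperconductivity.HubbardSuperconductivity.Theorems.PerturbedXYOrder

open MeasureTheory Literature.Probability.LatticeModels
open Summit.HubbardSuperconductivity.HubbardSuperconductivity.Theses.NodalWardXY

variable {L : ℕ}

/-- The Lebesgue volume of the cube `[0, 2π]^Λ` is `(2π)^|Λ|`. -/
theorem lap_volume_real_cube [NeZero L] :
    volume.real (cube L) = (2 * Real.pi) ^ Fintype.card (TorusSite 3 L) := by
  unfold cube
  rw [measureReal_def, volume_pi_pi]
  simp only [Real.volume_Icc, sub_zero, Finset.prod_const, Finset.card_univ, ENNReal.toReal_pow,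
    ENNReal.toReal_ofReal (by positivity : (0:ℝ) ≤ 2 * Real.pi)]

/-- The Lebesgue volume of a box `Π_x [c₀ x − δ, c₀ x + δ]` of half-width `δ ≥ 0` is `(2δ)^|Λ|`. -/
theorem lap_volume_real_box [NeZero L] (c₀ : TorusSite 3 L → ℝ) {δ : ℝ} (hδ : 0 ≤ δ) :
    volume.real (Set.pi Set.univ fun x : TorusSite 3 L => Set.Icc (c₀ x - δ) (c₀ x + δ)) =
      (2 * δ) ^ Fintype.card (TorusSite 3 L) := by
  rw [measureReal_def, volume_pi_pi]
  have h : ∀ x : TorusSite 3 L, volume (Set.Icc (c₀ x - δ) (c₀ x + δ)) = ENNReal.ofReal (2 * δ) := fun x => by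
    rw [Real.volume_Icc]; congr 1; ring
  simp only [h, Finset.prod_const, Finset.card_univ, ENNReal.toReal_pow,
    ENNReal.toReal_ofReal (by positivity : (0:ℝ) ≤ 2 * δ)]

/-- `Σ_{x,y} cos(θ_x − θ_y) ≤ L⁶` on `Λ = (ℤ/Lℤ)³` (each cosine is at most `1`, `|Λ|² = L⁶`). -/
theorem lap_sum_cos_le [NeZero L] (θ : TorusSite 3 L → ℝ) :
    ∑ x : TorusSite 3 L, ∑ y : TorusSite 3 L, Real.cos (θ x - θ y) ≤ (L : ℝ) ^ 6 := by
  calc ∑ x : TorusSite 3 L, ∑ y : TorusSite 3 L, Real.cos (θ x - θ y)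
      ≤ ∑ _x : TorusSite 3 L, ∑ _y : TorusSite 3 L, (1 : ℝ) :=
        Finset.sum_le_sum fun x _ => Finset.sum_le_sum fun y _ => Real.cos_le_one _
    _ = (L : ℝ) ^ 6 := by
        simp only [Finset.sum_const, Finset.card_univ, nsmul_eq_mul, mul_one, Fintype.card_fun,
          Fintype.card_fin, ZMod.card]
        push_cast; ring

/-- Pulling the double site sum inside the cube integral:
`Σ_{x,y} ∫_cube cos(θ_x − θ_y) e^{F} = ∫_cube (Σ_{x,y} cos(θ_x − θ_y)) e^{F}` for continuous `F`. -/
theorem lap_sum_integral_eq [NeZero L] {F : (TorusSite 3 L → ℝ) → ℝ} (hF : Continuous F) :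
    (∑ x : TorusSite 3 L, ∑ y : TorusSite 3 L, ∫ θ in cube L, Real.cos (θ x - θ y) * Real.exp (F θ)) =
      ∫ θ in cube L, (∑ x : TorusSite 3 L, ∑ y : TorusSite 3 L, Real.cos (θ x - θ y)) * Real.exp (F θ) := by
  have hint : ∀ x y : TorusSite 3 L,
      IntegrableOn (fun θ : TorusSite 3 L → ℝ => Real.cos (θ x - θ y) * Real.exp (F θ)) (cube L) volume :=
    fun x y => (by fun_prop : Continuous fun θ : TorusSite 3 L → ℝ =>
      Real.cos (θ x - θ y) * Real.exp (F θ)).continuousOn.integrableOn_compact ent_isCompact_cube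
  have hint' : ∀ x : TorusSite 3 L, IntegrableOn
      (fun θ : TorusSite 3 L → ℝ => ∑ y : TorusSite 3 L, Real.cos (θ x - θ y) * Real.exp (F θ)) (cube L) volume :=
    fun x => (by fun_prop : Continuous fun θ : TorusSite 3 L → ℝ =>
      ∑ y : TorusSite 3 L, Real.cos (θ x - θ y) * Real.exp (F θ)).continuousOn.integrableOn_compact
        ent_isCompact_cube
  simp_rw [Finset.sum_mul]
  rw [integral_finsetSum _ fun x _ => hint' x]
  refine Finset.sum_congr rfl fun x _ => ?_
  rw [integral_finsetSum _ fun y _ => hint x y]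

/-- **The box bounds the partition function from below.** If `F ≥ R_N` on a box
`Π_x [c₀ x − δ, c₀ x + δ] ⊆ cube`, then `(2δ)^|Λ| e^{R_N} ≤ ∫_cube e^{F}`. -/
theorem lap_box_le_integral [NeZero L] {F : (TorusSite 3 L → ℝ) → ℝ} (hF : Continuous F) {RN δ : ℝ}
    (c₀ : TorusSite 3 L → ℝ) (hδ : 0 ≤ δ)
    (hbox : (Set.pi Set.univ fun x : TorusSite 3 L => Set.Icc (c₀ x - δ) (c₀ x + δ)) ⊆ cube L)
    (hN : ∀ θ ∈ (Set.pi Set.univ fun x : TorusSite 3 L => Set.Icc (c₀ x - δ) (c₀ x + δ)), RN ≤ F θ) :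
    (2 * δ) ^ Fintype.card (TorusSite 3 L) * Real.exp RN ≤ ∫ θ in cube L, Real.exp (F θ) := by
  have hwi : IntegrableOn (fun θ => Real.exp (F θ)) (cube L) volume :=
    hF.rexp.continuousOn.integrableOn_compact ent_isCompact_cube
  have hcube_fin : volume (cube L) < ⊤ := ent_isCompact_cube.measure_lt_top
  have hBox_meas : MeasurableSet (Set.pi Set.univ fun x : TorusSite 3 L => Set.Icc (c₀ x - δ) (c₀ x + δ)) :=
    MeasurableSet.univ_pi fun _ => measurableSet_Icc
  have h1 : Real.exp RN * volume.real (Set.pi Set.univ fun x : TorusSite 3 L => Set.Icc (c₀ x - δ) (c₀ x + δ)) ≤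
      ∫ θ in (Set.pi Set.univ fun x : TorusSite 3 L => Set.Icc (c₀ x - δ) (c₀ x + δ)), Real.exp (F θ) :=
    setIntegral_ge_of_const_le_real hBox_meas ((measure_mono hbox).trans_lt hcube_fin).ne
      (fun θ hθ => Real.exp_le_exp.2 (hN θ hθ)) (hwi.mono_set hbox)
  have h2 : ∫ θ in (Set.pi Set.univ fun x : TorusSite 3 L => Set.Icc (c₀ x - δ) (c₀ x + δ)), Real.exp (F θ) ≤
      ∫ θ in cube L, Real.exp (F θ) :=
    setIntegral_mono_set hwi (ae_of_all _ fun θ => (Real.exp_pos _).le) (LE.le.eventuallyLE hbox)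
  rw [lap_volume_real_box c₀ hδ, mul_comm] at h1
  exact h1.trans h2

/-- **Energy–entropy splitting of the cube** at a level set of a continuous observable `C ≤ M` (`M ≥ 0`,
`a ≥ 0`): if `F ≤ R_A` on `cube ∩ {a/2 · M ≤ C}`, then
`∫_cube C e^{F} ≤ (a/2) M ∫_cube e^{F} + M (2π)^|Λ| e^{R_A}`. -/
theorem lap_integral_mul_exp_le [NeZero L] {F C : (TorusSite 3 L → ℝ) → ℝ} (hF : Continuous F)
    (hC : Continuous C) {a M RA : ℝ} (ha : 0 ≤ a) (hM : 0 ≤ M) (hCM : ∀ θ, C θ ≤ M)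
    (hA : ∀ θ ∈ cube L, a / 2 * M ≤ C θ → F θ ≤ RA) :
    ∫ θ in cube L, C θ * Real.exp (F θ) ≤
      a / 2 * M * (∫ θ in cube L, Real.exp (F θ)) +
        M * ((2 * Real.pi) ^ Fintype.card (TorusSite 3 L) * Real.exp RA) := by
  set A : Set (TorusSite 3 L → ℝ) := {θ | a / 2 * M ≤ C θ} with hAdef
  have hcube_meas : MeasurableSet (cube L) := ent_isCompact_cube.measurableSet
  have hcube_fin : volume (cube L) < ⊤ := ent_isCompact_cube.measure_lt_top
  have hA_meas : MeasurableSet A := measurableSet_le measurable_const hC.measurable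
  have hwi : IntegrableOn (fun θ => Real.exp (F θ)) (cube L) volume :=
    hF.rexp.continuousOn.integrableOn_compact ent_isCompact_cube
  have hCwi : IntegrableOn (fun θ => C θ * Real.exp (F θ)) (cube L) volume :=
    (hC.mul hF.rexp).continuousOn.integrableOn_compact ent_isCompact_cube
  have hsplit : ∫ θ in cube L, C θ * Real.exp (F θ) =
      (∫ θ in cube L ∩ A, C θ * Real.exp (F θ)) + ∫ θ in cube L \ A, C θ * Real.exp (F θ) :=
    (integral_inter_add_sdiff hA_meas hCwi).symm
  -- the level set: `C ≤ M`, `e^F ≤ e^{R_A}`, `vol(cube ∩ A) ≤ (2π)^|Λ|`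
  have hgood : ∫ θ in cube L ∩ A, C θ * Real.exp (F θ) ≤
      M * ((2 * Real.pi) ^ Fintype.card (TorusSite 3 L) * Real.exp RA) := by
    have h1 : ∫ θ in cube L ∩ A, C θ * Real.exp (F θ) ≤ ∫ θ in cube L ∩ A, M * Real.exp (F θ) :=
      setIntegral_mono_on (hCwi.mono_set Set.inter_subset_left)
        ((hwi.mono_set Set.inter_subset_left).const_mul M) (hcube_meas.inter hA_meas)
        fun θ _ => mul_le_mul_of_nonneg_right (hCM θ) (Real.exp_pos _).le
    have h2 : ∫ θ in cube L ∩ A, Real.exp (F θ) ≤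
        Real.exp RA * (2 * Real.pi) ^ Fintype.card (TorusSite 3 L) := by
      calc ∫ θ in cube L ∩ A, Real.exp (F θ) ≤ ‖∫ θ in cube L ∩ A, Real.exp (F θ)‖ := Real.le_norm_self _
        _ ≤ Real.exp RA * volume.real (cube L ∩ A) :=
            norm_setIntegral_le_of_norm_le_const ((measure_mono Set.inter_subset_left).trans_lt hcube_fin)
              fun θ hθ => by
                rw [Real.norm_eq_abs, abs_of_pos (Real.exp_pos _)]
                exact Real.exp_le_exp.2 (hA θ hθ.1 hθ.2)
        _ ≤ Real.exp RA * (2 * Real.pi) ^ Fintype.card (TorusSite 3 L) := by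
            rw [← lap_volume_real_cube (L := L)]
            exact mul_le_mul_of_nonneg_left (measureReal_mono Set.inter_subset_left hcube_fin.ne)
              (Real.exp_pos _).le
    rw [integral_const_mul] at h1
    calc ∫ θ in cube L ∩ A, C θ * Real.exp (F θ) ≤ M * ∫ θ in cube L ∩ A, Real.exp (F θ) := h1
      _ ≤ M * (Real.exp RA * (2 * Real.pi) ^ Fintype.card (TorusSite 3 L)) := mul_le_mul_of_nonneg_left h2 hM
      _ = M * ((2 * Real.pi) ^ Fintype.card (TorusSite 3 L) * Real.exp RA) := by ring
  -- off the level set: `C < (a/2) M`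
  have hbad : ∫ θ in cube L \ A, C θ * Real.exp (F θ) ≤ a / 2 * M * ∫ θ in cube L, Real.exp (F θ) := by
    have h1 : ∫ θ in cube L \ A, C θ * Real.exp (F θ) ≤ ∫ θ in cube L \ A, a / 2 * M * Real.exp (F θ) :=
      setIntegral_mono_on (hCwi.mono_set Set.sdiff_subset) ((hwi.mono_set Set.sdiff_subset).const_mul _)
        (hcube_meas.diff hA_meas) fun θ hθ =>
          mul_le_mul_of_nonneg_right (not_le.1 hθ.2).le (Real.exp_pos _).le
    have h2 : ∫ θ in cube L \ A, Real.exp (F θ) ≤ ∫ θ in cube L, Real.exp (F θ) :=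
      setIntegral_mono_set hwi (ae_of_all _ fun θ => (Real.exp_pos _).le) (LE.le.eventuallyLE Set.sdiff_subset)
    rw [integral_const_mul] at h1
    exact h1.trans (mul_le_mul_of_nonneg_left h2 (by positivity))
  rw [hsplit]
  linarith

/-- STUB (c5 tightness, M): **energy–entropy on the cube** (generic). For a continuous `F` and `a ≥ 0`, if `F ≤ R_A` wherever
`Σcos(θ_x−θ_y) ≥ (a/2)L⁶` on the cube and `F ≥ R_N` on a box `Π_x [c₀ x − δ, c₀ x + δ] ⊆ cube`, then the `e^F`-average of
`Σcos(θ_x−θ_y)` over the cube is at most `(a/2)L⁶ + L⁶ (2π)^|Λ| e^(R_A) / ((2δ)^|Λ| e^(R_N))` (split the cube at the level set;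
`Σcos ≤ L⁶`; bound `∫_A e^F` by `vol(cube)·e^(R_A)` and `∫_cube e^F` from below by the box). -/
theorem stub_e3Laplace (L : ℕ) [NeZero L] (F : (TorusSite 3 L → ℝ) → ℝ) (hF : Continuous F)
    (a RA RN δ : ℝ) (ha : 0 ≤ a) (c₀ : TorusSite 3 L → ℝ) (hδ : 0 < δ)
    (hbox : (Set.pi Set.univ fun x : TorusSite 3 L => Set.Icc (c₀ x - δ) (c₀ x + δ)) ⊆ cube L)
    (hA : ∀ θ ∈ cube L, a / 2 * (L : ℝ) ^ 6 ≤ ∑ x : TorusSite 3 L, ∑ y : TorusSite 3 L, Real.cos (θ x - θ y) →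
      F θ ≤ RA)
    (hN : ∀ θ ∈ (Set.pi Set.univ fun x : TorusSite 3 L => Set.Icc (c₀ x - δ) (c₀ x + δ)), RN ≤ F θ) :
    (∑ x : TorusSite 3 L, ∑ y : TorusSite 3 L, ∫ θ in cube L, Real.cos (θ x - θ y) * Real.exp (F θ)) /
        (∫ θ in cube L, Real.exp (F θ)) ≤
      a / 2 * (L : ℝ) ^ 6 +
        (L : ℝ) ^ 6 * ((2 * Real.pi) ^ Fintype.card (TorusSite 3 L) * Real.exp RA /
          ((2 * δ) ^ Fintype.card (TorusSite 3 L) * Real.exp RN)) := by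
  have hL6 : (0:ℝ) ≤ (L : ℝ) ^ 6 := by positivity
  have hCc : Continuous fun θ : TorusSite 3 L → ℝ =>
      ∑ x : TorusSite 3 L, ∑ y : TorusSite 3 L, Real.cos (θ x - θ y) := by
    fun_prop
  have hnum := lap_integral_mul_exp_le
    (C := fun θ => ∑ x : TorusSite 3 L, ∑ y : TorusSite 3 L, Real.cos (θ x - θ y))
    hF hCc ha hL6 lap_sum_cos_le hA
  have hden := lap_box_le_integral hF c₀ hδ.le hbox hN
  have hD : 0 < (2 * δ) ^ Fintype.card (TorusSite 3 L) * Real.exp RN := by positivity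
  have hZ : 0 < ∫ θ in cube L, Real.exp (F θ) := hD.trans_le hden
  have hX : (2 * Real.pi) ^ Fintype.card (TorusSite 3 L) * Real.exp RA ≤
      (2 * Real.pi) ^ Fintype.card (TorusSite 3 L) * Real.exp RA /
        ((2 * δ) ^ Fintype.card (TorusSite 3 L) * Real.exp RN) * ∫ θ in cube L, Real.exp (F θ) := by
    rw [div_mul_eq_mul_div, le_div_iff₀ hD]
    exact mul_le_mul_of_nonneg_left hden (by positivity)
  have hX' := mul_le_mul_of_nonneg_left hX hL6
  rw [lap_sum_integral_eq hF, div_le_iff₀ hZ]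
  calc ∫ θ in cube L, (∑ x : TorusSite 3 L, ∑ y : TorusSite 3 L, Real.cos (θ x - θ y)) * Real.exp (F θ)
      ≤ a / 2 * (L : ℝ) ^ 6 * (∫ θ in cube L, Real.exp (F θ)) +
          (L : ℝ) ^ 6 * ((2 * Real.pi) ^ Fintype.card (TorusSite 3 L) * Real.exp RA) := hnum
    _ ≤ a / 2 * (L : ℝ) ^ 6 * (∫ θ in cube L, Real.exp (F θ)) +
          (L : ℝ) ^ 6 * ((2 * Real.pi) ^ Fintype.card (TorusSite 3 L) * Real.exp RA /
            ((2 * δ) ^ Fintype.card (TorusSite 3 L) * Real.exp RN) * ∫ θ in cube L, Real.exp (F θ)) :=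
        add_le_add le_rfl hX'
    _ = (a / 2 * (L : ℝ) ^ 6 +
          (L : ℝ) ^ 6 * ((2 * Real.pi) ^ Fintype.card (TorusSite 3 L) * Real.exp RA /
            ((2 * δ) ^ Fintype.card (TorusSite 3 L) * Real.exp RN))) * ∫ θ in cube L, Real.exp (F θ) := by
        ring

end Summit.HubbardSuperconductivity.HubbardSuperconductivity.Theorems.PerturbedXYOrder

end
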